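import Summits.ResolutionOfSingularities.ResolutionOfSingularities.Theorems.WeightedInvariantHypersurfaceCentreAssemblyPullback
import Summits.ResolutionOfSingularities.ResolutionOfSingularities.Theorems.WeightedInvariantDatumToEmbeddedInvDrop
import Summits.ResolutionOfSingularities.ResolutionOfSingularities.Theorems.WeightedInvariantDatumToEmbeddedExceptional
import HarnessLib

/-!
# Door assembly H2c″, stub [S6] — K4-E: the local rings of `B₊` as local rings of the chart algebras and of the
# GAME-SIDE carrier (stalk chain `Ψ`, strict transform ↦ `t⁻¹`-saturation)

Route `ResolutionOfSingularities/WeightedInvariant`, crux `Theses.WeightedInvariant.HypersurfaceCentreConstruction`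
(stmt-ResolutionOfSingularities-19897), door line `local-engine`, stub [S6] `stub_iotaMax_lt_of_step`; plan of record
`HOME/D/res-D-brk-1/S6-PLAN.md` (sha16 44bfca18104087b1) §K4-E of res-L1-w43-stub-9 = res-D-brk-1, written by
res-type-089 (res-L1-w43-plan-1 RULING gen 9 #2: «089 = K4-E») in a θ-FREE VARIANT: the chart is the cover map
`R'.openCover.f U : Spec ⊕ 𝒥ₙ(U) tⁿ ⟶ B` of the tree's global cobordant blow-up itself, restricted to the vertex complement
(no passage through `extReesAlgebra (chartIdeals U)`).

For a Rees filtration `R'` on `Y`, an affine open `U = Spec A`, `S := ⊕ₙ 𝒥ₙ(U) tⁿ = R'.sectionsRing U` and ANY morphism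
`φ : (Spec S ∖ V(S₊)) ⟶ B₊` over the cover map (`φ ≫ B₊.ι = (plusChart U).ι ≫ R'.openCover.f U`; one exists,
`exists_plusChartFac`):
* `plusChartFac_comp_πPlus`, `πPlus_plusChartFac_mem`,
  `primeIdealOf_πPlus_plusChartFac(_asIdeal)` (the base point `y = σ₊(φ x) ∈ U` has prime `x ∩ A`),
  `exists_plusChartFac_apply_eq` (every point of `B₊` over `U` is some `φ x`), `not_irrelevant_le_of_plusChart`;
* `comap_strictTransformPlus_of_plusChartFac` — the strict transform `σˢ(K)|_{B₊}` pulls back along `φ` to (the restriction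
  of) the ideal sheaf of the `t⁻¹`-saturation `⋃ₙ (K(U)·S : t⁻ⁿ)` (needs `B` locally Noetherian — the tree's section calculus of
  `σˢ`, `InvDrop.comap_chart_strictTransform`);
* `exists_stalk_ringEquiv_of_plusChartFac` — **K4-E (I)**: a ring isomorphism `Ψ₀ : 𝒪_{B₊, φ x} ≃+* S_q` carrying the stalk of
  `σˢ(K)|_{B₊}` onto `⋃ₙ (K(U) S_q : (t⁻¹/1)ⁿ)`, for every `K`;
* (sequel file `…AssemblyPlusStalkGameSide.lean`) `exists_gameSide_stalk_model_of_plusChartFac` / **`exists_gameSide_stalk_model`** (chart-free, point-based) — composed with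
  res-type-048's CHART → GAME-SIDE package (`exists_prime_extReesAlgebra_ringEquiv_localization_T`, p509387): for
  `A' = A_{𝔮_y}` (`y = σ₊(y')`, the model `Localization.AtPrime (U.2.primeIdealOf ⟨y, _⟩).asIdeal` of the assembly dictionaries)
  and ideals `I'ₙ = 𝒥ₙ(U) A'`, a prime `𝔫'` of `extReesAlgebra I'` and `Ψ : 𝒪_{B₊, y'} ≃+* (extReesAlgebra I')_{𝔫'}` with the
  stalk of `σˢ(K)|_{B₊}` carried onto `⋃ₙ (K(U) · (extReesAlgebra I')_{𝔫'} : (t⁻¹/1)ⁿ)` for every `K`, `𝔫'` off the vertex and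
  over the closed point of `A'`;
* **`exists_gameSide_readOff`** — for a locally principal strict transform and `B₊ → Spec k` smooth: in addition a generator
  `γ` of that saturation with `iotaAt ι X' y' = ι(O', γ)`, `y' ∈ singImage X' → γ ∈ 𝔪_{O'}²`, `O'` regular (Pullback READ-OFF).
These are the common inputs of the EXCEPTIONAL half (stub-9) and the TORUS half (res-type-057) of [S6].
Engineering note: every step touching local rings of the glued scheme `B₊` is an APPLICATION of a lemma proved over variable
schemes/rings (no `rw` inside goals carrying those types), and all `S`-level types are spelled on the plain ring
`R'.sectionsRing U` (points as `PrimeSpectrum (R'.sectionsRing U)`), never on `↑(CommRingCat.of _)`.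
Def-free; OURS bookkeeping; no claim about Hironaka's problem. [cite: Wlodarczyk2022, Def. 5.1.1; 3.3.12]
-/

noncomputable section

set_option linter.dupNamespace false -- mandated namespace of this single-conjunct summit

open CategoryTheory AlgebraicGeometry TopologicalSpace IsLocalRing
open scoped LaurentPolynomial
open LaurentPolynomial
open Literature.AlgebraicGeometry.Resolution
open Summit.ResolutionOfSingularities.ResolutionOfSingularities.Theorems

namespace Summit.ResolutionOfSingularities.ResolutionOfSingularities.Cruxes.HypersurfaceCentreConstruction.LocalEngine

/-! ## Generic algebra -/

section Generic

/-- `I ↦ I.map` along `e₁ ≫ e₂` in two steps. [folklore] -/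
theorem ideal_map_ringEquiv_trans₂ {A B C : Type*} [CommRing A] [CommRing B] [CommRing C]
    (e₁ : A ≃+* B) (e₂ : B ≃+* C) {I : Ideal A} {J : Ideal B} {M : Ideal C}
    (h₁ : I.map (e₁ : A →+* B) = J) (h₂ : J.map (e₂ : B →+* C) = M) :
    I.map ((e₁.trans e₂ : A ≃+* C) : A →+* C) = M := by
  subst h₁ h₂
  rw [RingEquiv.coe_ringHom_trans, Ideal.map_map]

/-- `I ↦ I.map` along `e₁ ≫ e₂⁻¹ ≫ e₃` in three steps. [folklore] -/
theorem ideal_map_ringEquiv_trans₃ {A B C D : Type*} [CommRing A] [CommRing B] [CommRing C]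
    [CommRing D] (e₁ : A ≃+* B) (e₂ : C ≃+* B) (e₃ : C ≃+* D) {I : Ideal A} {J : Ideal B} {L : Ideal C}
    {M : Ideal D} (h₁ : I.map (e₁ : A →+* B) = J) (h₂ : J.map (e₂.symm : B →+* C) = L)
    (h₃ : L.map (e₃ : C →+* D) = M) :
    I.map ((e₁.trans (e₂.symm.trans e₃) : A ≃+* D) : A →+* D) = M := by
  subst h₁ h₂ h₃
  rw [RingEquiv.coe_ringHom_trans, RingEquiv.coe_ringHom_trans, ← Ideal.map_map, ← Ideal.map_map]

/-- A principal ideal stays principal along a ring isomorphism, backwards. [folklore] -/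
theorem exists_eq_span_singleton_of_map_ringEquiv {A B : Type*} [CommRing A] [CommRing B] (e : A ≃+* B)
    {I : Ideal A} (h : ∃ g : B, I.map (e : A →+* B) = Ideal.span {g}) : ∃ g : A, I = Ideal.span {g} := by
  obtain ⟨g, hg⟩ := h
  refine ⟨e.symm g, ?_⟩
  rw [← Ideal.map_of_equiv (I := I) e, hg, Ideal.map_span, Set.image_singleton]
  rfl

/-- A principal ideal stays principal along a ring isomorphism. [folklore] -/
theorem exists_map_ringEquiv_eq_span_singleton {A B : Type*} [CommRing A] [CommRing B] (e : A ≃+* B)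
    {I : Ideal A} (h : ∃ g : A, I = Ideal.span {g}) : ∃ g : B, I.map (e : A →+* B) = Ideal.span {g} := by
  obtain ⟨g, rfl⟩ := h
  exact ⟨e g, by rw [Ideal.map_span, Set.image_singleton]; rfl⟩

/-- The two spellings of the `t`-saturation of an ideal agree: colon by the ideal `(t)ⁿ` versus colon by the element `tⁿ`.
[folklore] -/
theorem iSup_colon_span_pow_eq_iSup_colon_singleton_pow {S : Type*} [CommRing S] (J : Ideal S) (t : S) :
    (⨆ n : ℕ, J.colon ((Ideal.span {t} ^ n : Ideal S) : Set S)) = ⨆ n : ℕ, J.colon {t ^ n} := by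
  ext x
  rw [DatumToEmbedded.StrictTransform.mem_iSup_colon_span_singleton_pow_iff, mem_iSup_ideal_colon_singleton_pow_iff]

/-- Extension of a principal ideal along a ring map (binders at the `Semiring` level, so that they are ASSIGNED by
unification from the `Ideal.map` term — no class synthesis on the carriers). [folklore] -/
theorem ideal_map_span_singleton {R S : Type*} [Semiring R] [Semiring S] (f : R →+* S) (z : R) :
    (Ideal.span {z}).map f = Ideal.span {f z} := by
  rw [Ideal.map_span, Set.image_singleton]

/-- A ring isomorphism of local rings carries `𝔪ⁿ` into `𝔪ⁿ` (generic carriers: every instance is derived from the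
`CommRing` binders, which is the spelling consumers of `exists_gameSide_readOff` receive). [folklore] -/
theorem map_mem_pow_maximalIdeal_of_ringEquiv {R S : Type*} [CommRing R] [CommRing S] [IsLocalRing R] [IsLocalRing S]
    (e : R ≃+* S) {x : R} {n : ℕ} (hx : x ∈ maximalIdeal R ^ n) : e x ∈ maximalIdeal S ^ n := by
  have hne : (maximalIdeal R).map (e : R →+* S) ≠ ⊤ := by
    rw [Ideal.map_comap_of_equiv]
    exact Ideal.comap_ne_top _ (IsLocalRing.maximalIdeal.isMaximal R).ne_top
  have hle : (maximalIdeal R ^ n).map (e : R →+* S) ≤ maximalIdeal S ^ n := by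
    rw [Ideal.map_pow]
    exact Ideal.pow_right_mono (IsLocalRing.le_maximalIdeal hne) n
  exact hle (Ideal.mem_map_of_mem (e : R →+* S) hx)

/-- **K4-B with the localisation model**: on `Spec S`, a ring isomorphism `𝒪_{Spec S, q} ≃+* S_q` carrying the stalk of the
ideal sheaf of every ideal `I ≤ S` onto `I S_q` (`stalkIdeal_ofIdealTop_eq_map` + `IsLocalization.algEquiv`; the point is
taken in `PrimeSpectrum S` so that `S_q` carries the plain instances of `S`). [folklore] -/
theorem exists_stalk_ringEquiv_localization_Spec {S : Type} [CommRing S] (q : PrimeSpectrum S) :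
    ∃ E : (Spec (CommRingCat.of S)).presheaf.stalk q ≃+* Localization.AtPrime q.asIdeal,
      ∀ I : Ideal S, (stalkIdeal (Scheme.IdealSheafData.ofIdealTop
          (I.map (Scheme.ΓSpecIso (CommRingCat.of S)).inv.hom)) q).map
          (E : (Spec (CommRingCat.of S)).presheaf.stalk q →+* Localization.AtPrime q.asIdeal) =
        I.map (algebraMap S (Localization.AtPrime q.asIdeal)) := by
  let E : (Spec.structureSheaf S).presheaf.stalk q ≃+* Localization.AtPrime q.asIdeal :=
    (IsLocalization.algEquiv q.asIdeal.primeCompl ((Spec.structureSheaf S).presheaf.stalk q)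
      (Localization.AtPrime q.asIdeal)).toRingEquiv
  have hE : (E : (Spec.structureSheaf S).presheaf.stalk q →+* Localization.AtPrime q.asIdeal).comp
      (StructureSheaf.toStalk S q).hom = algebraMap S (Localization.AtPrime q.asIdeal) := by
    ext s
    exact (IsLocalization.algEquiv q.asIdeal.primeCompl ((Spec.structureSheaf S).presheaf.stalk q)
      (Localization.AtPrime q.asIdeal)).commutes s
  refine ⟨E, fun I => ?_⟩
  rw [stalkIdeal_ofIdealTop_eq_map]
  erw [Ideal.map_map, hE]

end Generic


/-! ## res-type-048's CHART → GAME-SIDE package, respelled on `R'.sectionsRing U` -/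

section Package

variable {Y : Scheme.{0}} (R' : ReesFiltration Y) (U : Y.affineOpens)

/-- res-type-048's package `exists_prime_extReesAlgebra_ringEquiv_localization_T` (p509387) for the filtration
`R'.filtration U`, with its extended Rees algebra spelled as the chart algebra `R'.sectionsRing U` (an `abbrev` for it) —
so that downstream statements carry ONE spelling of the chart algebra. [cite: Wlodarczyk2022, Def. 5.1.1] -/
theorem exists_prime_extReesAlgebra_ringEquiv_localization_T_sectionsRing
    {A' : Type} [CommRing A'] [Algebra Γ(Y, U) A'] (M : Submonoid Γ(Y, U)) [IsLocalization M A']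
    {I' : ℕ → Ideal A'} (hI' : ∀ n, I' n = ((R'.ideal n).ideal U).map (algebraMap Γ(Y, U) A'))
    (𝔫 : Ideal (R'.sectionsRing U)) [𝔫.IsPrime]
    (hd : Disjoint ((M.map (algebraMap Γ(Y, U) (R'.sectionsRing U)) : Submonoid (R'.sectionsRing U)) :
      Set (R'.sectionsRing U)) 𝔫) :
    ∃ (𝔫' : Ideal (extReesAlgebra I')) (_ : 𝔫'.IsPrime)
      (g : Localization.AtPrime 𝔫 ≃+* Localization.AtPrime 𝔫'),
      (∀ a : Γ(Y, U), g (algebraMap (R'.sectionsRing U) (Localization.AtPrime 𝔫)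
          (algebraMap Γ(Y, U) (R'.sectionsRing U) a)) =
          algebraMap (extReesAlgebra I') _ (algebraMap A' (extReesAlgebra I') (algebraMap Γ(Y, U) A' a))) ∧
      (extReesAlgebra.tInv I' ∈ 𝔫' ↔
        (⟨T (-1), (R'.filtration U).T_neg_one_mem_extendedRees⟩ : R'.sectionsRing U) ∈ 𝔫) ∧
      (extReesAlgebra.vertexIdeal I' ≤ 𝔫' ↔ (R'.filtration U).irrelevant ≤ 𝔫) ∧
      (∀ 𝔭 : Ideal Γ(Y, U), (𝔭.map (algebraMap Γ(Y, U) A')).map (algebraMap A' (extReesAlgebra I')) ≤ 𝔫' ↔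
          𝔭.map (algebraMap Γ(Y, U) (R'.sectionsRing U)) ≤ 𝔫) ∧
      g (algebraMap (R'.sectionsRing U) (Localization.AtPrime 𝔫)
          ⟨T (-1), (R'.filtration U).T_neg_one_mem_extendedRees⟩) =
        algebraMap (extReesAlgebra I') _ (extReesAlgebra.tInv I') :=
  exists_prime_extReesAlgebra_ringEquiv_localization_T (R'.filtration U) M hI' 𝔫 hd

end Package

/-! ## The chart `φ_U : Spec ⊕ 𝒥ₙ(U) tⁿ ∖ V(⊕_{n>0} 𝒥ₙ(U) tⁿ) ⟶ B₊` -/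

section Chart

variable {Y : Scheme.{0}} (R' : ReesFiltration Y) (U : Y.affineOpens)

-- the cover maps `R'.openCover.f U` are stated on `R'.openCover.obj U`, which is `Spec (R'.sectionsRing U)` only up to
-- unfolding the relative gluing (instance problem `IsOpenImmersion (R'.openCover.f U)`; as in `…DatumToEmbeddedInvDrop`):
set_option backward.isDefEq.respectTransparency false in
/-- **The chart `φ_U` exists**: the cover map of `B = Spec_Y ⊕ 𝒥ₙ tⁿ` over `U`, restricted to the vertex complements
(`image_plusChart_le_plus`), an open immersion. [cite: Wlodarczyk2022, Def. 5.1.1] -/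
theorem exists_plusChartFac :
    ∃ (φ : (R'.plusChart U : Scheme.{0}) ⟶ (R'.plus : Scheme.{0})) (_ : IsOpenImmersion φ),
      φ ≫ R'.plus.ι = (R'.plusChart U).ι ≫ R'.openCover.f ⟨U.1, U.2⟩ := by
  refine ⟨Scheme.Hom.resLE _ R'.plus (R'.plusChart U)
    (fun q hq => R'.image_plusChart_le_plus ⟨U.1, U.2⟩ ⟨q, hq, rfl⟩), ?_, Scheme.Hom.resLE_comp_ι _ _⟩
  have h : IsOpenImmersion (Scheme.Hom.resLE (R'.openCover.f ⟨U.1, U.2⟩) R'.plus (R'.plusChart U)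
      (fun q hq => R'.image_plusChart_le_plus ⟨U.1, U.2⟩ ⟨q, hq, rfl⟩) ≫ R'.plus.ι) := by
    rw [Scheme.Hom.resLE_comp_ι]
    infer_instance
  exact IsOpenImmersion.of_comp _ R'.plus.ι

/-- **K4-E (III)**: a point of the chart's vertex complement misses the irrelevant ideal `⊕_{n>0} 𝒥ₙ(U) tⁿ`
(`q` = the point `x` read in `PrimeSpectrum S`). [folklore] -/
theorem not_irrelevant_le_of_plusChart (x : (R'.plusChart U : Scheme.{0}))
    (q : PrimeSpectrum (R'.sectionsRing U)) (hq : (R'.plusChart U).ι x = q) :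
    ¬ (R'.filtration U).irrelevant ≤ q.asIdeal := by
  subst hq
  exact (R'.mem_plusChart_iff U x.1).mp x.2

set_option maxHeartbeats 400000 in
/-- K4-A backwards along the inclusion of the vertex complement: an isomorphism `𝒪_{Spec S, q} ≅ 𝒪_{chart, x}` carrying
`L_q` to `(L|_{chart})_x`, stated at the point `q` of `PrimeSpectrum S` under `x`. [folklore] -/
theorem exists_stalk_ringEquiv_plusChartι (x : (R'.plusChart U : Scheme.{0}))
    (q : PrimeSpectrum (R'.sectionsRing U)) (hq : (R'.plusChart U).ι x = q) :
    ∃ E₂ : (Spec (CommRingCat.of (R'.sectionsRing U))).presheaf.stalk q ≃+*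
        (R'.plusChart U : Scheme.{0}).presheaf.stalk x,
      ∀ L : (Spec (CommRingCat.of (R'.sectionsRing U))).IdealSheafData,
        (stalkIdeal (L.comap (R'.plusChart U).ι) x).map
          (E₂.symm : (R'.plusChart U : Scheme.{0}).presheaf.stalk x →+*
            (Spec (CommRingCat.of (R'.sectionsRing U))).presheaf.stalk q) = stalkIdeal L q := by
  subst hq
  refine ⟨(asIso ((R'.plusChart U).ι.stalkMap x)).commRingCatIsoToRingEquiv, fun L => ?_⟩
  rw [stalkIdeal_comap_eq_map_ringEquiv (R'.plusChart U).ι L x]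
  exact Ideal.map_of_equiv _

variable (φ : (R'.plusChart U : Scheme.{0}) ⟶ (R'.plus : Scheme.{0}))
  (hφ : φ ≫ R'.plus.ι = (R'.plusChart U).ι ≫ R'.openCover.f ⟨U.1, U.2⟩)

include hφ

/-- **`φ_U` lies over `Spec ⊕ 𝒥ₙ(U) tⁿ → Spec A ≅ U ⊆ Y`** (`R'.ι_π`). [cite: Wlodarczyk2022, Def. 5.1.1] -/
theorem plusChartFac_comp_πPlus :
    φ ≫ R'.πPlus = (R'.plusChart U).ι ≫
      Spec.map (CommRingCat.ofHom (algebraMap Γ(Y, U) (R'.sectionsRing U))) ≫ U.2.fromSpec := by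
  rw [ReesFiltration.πPlus, ← Category.assoc, hφ, Category.assoc]
  exact congrArg (fun ψ => (R'.plusChart U).ι ≫ ψ) (R'.ι_π ⟨U.1, U.2⟩)

/-- The base point of `φ_U x` is `fromSpec (x ∩ A)`. [folklore] -/
theorem πPlus_plusChartFac_apply (x : (R'.plusChart U : Scheme.{0})) :
    R'.πPlus (φ x) =
      U.2.fromSpec (Spec.map (CommRingCat.ofHom (algebraMap Γ(Y, U) (R'.sectionsRing U))) x.1) := by
  have h := congrArg (fun ψ => ψ x) (plusChartFac_comp_πPlus R' U φ hφ)
  simp only [Scheme.Hom.comp_apply, Scheme.Opens.ι_apply] at h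
  exact h

/-- The base point of `φ_U x` lies in `U`. [folklore] -/
theorem πPlus_plusChartFac_mem (x : (R'.plusChart U : Scheme.{0})) : R'.πPlus (φ x) ∈ (U : Y.Opens) := by
  rw [πPlus_plusChartFac_apply R' U φ hφ x]
  have h := Set.mem_range_self (f := fun p => U.2.fromSpec p)
    (Spec.map (CommRingCat.ofHom (algebraMap Γ(Y, U) (R'.sectionsRing U))) x.1)
  rw [U.2.range_fromSpec] at h
  exact h

/-- **K4-E (II): the prime of the base point** `y = σ₊(φ_U x) ∈ U` in `A = Γ(Y, U)` is `x ∩ A`. [folklore] -/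
theorem primeIdealOf_πPlus_plusChartFac (x : (R'.plusChart U : Scheme.{0})) :
    U.2.primeIdealOf ⟨R'.πPlus (φ x), πPlus_plusChartFac_mem R' U φ hφ x⟩ =
      Spec.map (CommRingCat.ofHom (algebraMap Γ(Y, U) (R'.sectionsRing U))) x.1 := by
  apply U.2.fromSpec.isOpenEmbedding.injective
  rw [IsAffineOpen.fromSpec_primeIdealOf]
  exact πPlus_plusChartFac_apply R' U φ hφ x

/-- The same, on ideals, at the point `q` of `PrimeSpectrum S` under `x`: `𝔮_y = q ∩ A`. [folklore] -/
theorem primeIdealOf_πPlus_plusChartFac_asIdeal (x : (R'.plusChart U : Scheme.{0}))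
    (q : PrimeSpectrum (R'.sectionsRing U)) (hq : (R'.plusChart U).ι x = q) :
    (U.2.primeIdealOf ⟨R'.πPlus (φ x), πPlus_plusChartFac_mem R' U φ hφ x⟩).asIdeal =
      q.asIdeal.comap (algebraMap Γ(Y, U) (R'.sectionsRing U)) := by
  rw [primeIdealOf_πPlus_plusChartFac R' U φ hφ x, ← hq]
  rfl

/-- **Joint surjectivity over `U`**: every point of `B₊` over `U` is `φ_U x` for some `x` off the vertex
(`DatumToEmbedded.Exceptional.exists_mem_plusChart`: `B₊ ∩ π⁻¹U` is the image of the chart's vertex complement). [folklore] -/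
theorem exists_plusChartFac_apply_eq (y' : (R'.plus : Scheme.{0})) (hy : R'.πPlus y' ∈ (U : Y.Opens)) :
    ∃ x : (R'.plusChart U : Scheme.{0}), φ x = y' := by
  obtain ⟨q, hq, hqy⟩ := DatumToEmbedded.Exceptional.exists_mem_plusChart R' y'.1 y'.2 U hy
  refine ⟨⟨q, hq⟩, Subtype.ext ?_⟩
  have h := congrArg (fun ψ => (ψ ⟨q, hq⟩ : R'.cobordantBlowup)) hφ
  simp only [Scheme.Hom.comp_apply, Scheme.Opens.ι_apply] at h
  rw [h]
  exact hqy

set_option backward.isDefEq.respectTransparency false in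
/-- **The strict transform on `B₊` pulls back along `φ_U` to the `t⁻¹`-saturation** `⋃ₙ (K(U) · S : (t⁻¹)ⁿ)` of the chart
algebra `S = ⊕ 𝒥ₙ(U) tⁿ` (its ideal sheaf on `Spec S`, restricted to the vertex complement). [cite: Wlodarczyk2022, 3.3.12] -/
theorem comap_strictTransformPlus_of_plusChartFac [IsLocallyNoetherian R'.cobordantBlowup] (K : Y.IdealSheafData) :
    (R'.strictTransformPlus K).comap φ =
      (Scheme.IdealSheafData.ofIdealTop ((⨆ n : ℕ, ((K.ideal U).map
        (algebraMap Γ(Y, U) (R'.sectionsRing U))).colon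
        ((Ideal.span {(⟨T (-1), (R'.filtration U).T_neg_one_mem_extendedRees⟩ :
          R'.sectionsRing U)} ^ n : Ideal (R'.sectionsRing U)) : Set (R'.sectionsRing U))).map
        (Scheme.ΓSpecIso (CommRingCat.of (R'.sectionsRing U))).inv.hom)).comap (R'.plusChart U).ι := by
  have h1 : (R'.strictTransformPlus K).comap φ =
      ((R'.strictTransform K).comap (R'.openCover.f ⟨U.1, U.2⟩)).comap (R'.plusChart U).ι := by
    rw [ReesFiltration.strictTransformPlus, ← Scheme.IdealSheafData.comap_comp, hφ, Scheme.IdealSheafData.comap_comp]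
  rw [h1]
  exact congrArg (fun L => Scheme.IdealSheafData.comap L (R'.plusChart U).ι)
    (DatumToEmbedded.InvDrop.comap_chart_strictTransform R' U (R'.openCover.f ⟨U.1, U.2⟩)
      (R'.ι_π ⟨U.1, U.2⟩) (R'.ι_toA1 ⟨U.1, U.2⟩) K)

/-- **K4-E (I): the local ring of `B₊` at `φ_U x` is the local ring `S_q` of the chart algebra** (`q` the point of
`PrimeSpectrum S` under `x`), by a ring isomorphism carrying, for every ideal sheaf `K` on `Y`, the stalk of the strict
transform `σˢ(K)|_{B₊}` onto the saturation `⋃ₙ (K(U) S_q : (t⁻¹/1)ⁿ)` (stalk maps of the open immersions `φ_U` and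
`(plusChart U).ι`, then `𝒪_{Spec S, q} ≅ S_q`; the strict transform through `comap_strictTransformPlus_of_plusChartFac`, K4-B
and `map_iSup_colon_singleton_pow`). [cite: Wlodarczyk2022, 3.3.12] -/
theorem exists_stalk_ringEquiv_of_plusChartFac [IsLocallyNoetherian R'.cobordantBlowup] [IsOpenImmersion φ]
    (x : (R'.plusChart U : Scheme.{0})) (q : PrimeSpectrum (R'.sectionsRing U)) (hq : (R'.plusChart U).ι x = q) :
    ∃ Ψ₀ : (R'.plus : Scheme.{0}).presheaf.stalk (φ x) ≃+* Localization.AtPrime q.asIdeal,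
      ∀ K : Y.IdealSheafData,
        (stalkIdeal (R'.strictTransformPlus K) (φ x)).map
            (Ψ₀ : (R'.plus : Scheme.{0}).presheaf.stalk (φ x) →+* Localization.AtPrime q.asIdeal) =
          ⨆ n : ℕ, (((K.ideal U).map (algebraMap Γ(Y, U) (R'.sectionsRing U))).map
            (algebraMap (R'.sectionsRing U) (Localization.AtPrime q.asIdeal))).colon
            {algebraMap (R'.sectionsRing U) (Localization.AtPrime q.asIdeal)
              ⟨T (-1), (R'.filtration U).T_neg_one_mem_extendedRees⟩ ^ n} := by
  -- the three isomorphisms: along `φ`, along the inclusion of the vertex complement, `𝒪_{Spec S, q} ≅ S_q`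
  let E₁ : (R'.plus : Scheme.{0}).presheaf.stalk (φ x) ≃+* (R'.plusChart U : Scheme.{0}).presheaf.stalk x :=
    (asIso (φ.stalkMap x)).commRingCatIsoToRingEquiv
  have hE20 := exists_stalk_ringEquiv_plusChartι R' U x q hq
  obtain ⟨E₂, hE₂⟩ := hE20
  have hE30 := exists_stalk_ringEquiv_localization_Spec (S := R'.sectionsRing U) q
  obtain ⟨E₃, hE₃⟩ := hE30
  refine ⟨E₁.trans (E₂.symm.trans E₃), fun K => ?_⟩
  -- along `φ` (K4-A)
  have h1 : (stalkIdeal (R'.strictTransformPlus K) (φ x)).map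
      (E₁ : (R'.plus : Scheme.{0}).presheaf.stalk (φ x) →+* (R'.plusChart U : Scheme.{0}).presheaf.stalk x) =
      stalkIdeal ((R'.strictTransformPlus K).comap φ) x :=
    (stalkIdeal_comap_eq_map_ringEquiv φ (R'.strictTransformPlus K) x).symm
  -- along the inclusion of the vertex complement (K4-A backwards), through the chart computation
  have h2 := (congrArg (fun Z : (R'.plusChart U : Scheme.{0}).IdealSheafData => (stalkIdeal Z x).map
      (E₂.symm : (R'.plusChart U : Scheme.{0}).presheaf.stalk x →+*
        (Spec (CommRingCat.of (R'.sectionsRing U))).presheaf.stalk q))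
      (comap_strictTransformPlus_of_plusChartFac R' U φ hφ K)).trans (hE₂ _)
  -- on `Spec S` (K4-B) into `S_q`, then the saturation bookkeeping in `S_q`
  have h3 := hE₃ (⨆ n : ℕ, ((K.ideal U).map (algebraMap Γ(Y, U) (R'.sectionsRing U))).colon
      ((Ideal.span {(⟨T (-1), (R'.filtration U).T_neg_one_mem_extendedRees⟩ : R'.sectionsRing U)} ^ n :
        Ideal (R'.sectionsRing U)) : Set (R'.sectionsRing U)))
  have h4 := (congrArg (Ideal.map (algebraMap (R'.sectionsRing U) (Localization.AtPrime q.asIdeal)))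
      (iSup_colon_span_pow_eq_iSup_colon_singleton_pow ((K.ideal U).map (algebraMap Γ(Y, U) (R'.sectionsRing U)))
        (⟨T (-1), (R'.filtration U).T_neg_one_mem_extendedRees⟩ : R'.sectionsRing U))).trans
    (map_iSup_colon_singleton_pow q.asIdeal (Localization.AtPrime q.asIdeal)
      ((K.ideal U).map (algebraMap Γ(Y, U) (R'.sectionsRing U)))
      (⟨T (-1), (R'.filtration U).T_neg_one_mem_extendedRees⟩ : R'.sectionsRing U))
  exact ideal_map_ringEquiv_trans₃ E₁ E₂ E₃ h1 h2 (h3.trans h4)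

end Chart

end Summit.ResolutionOfSingularities.ResolutionOfSingularities.Cruxes.HypersurfaceCentreConstruction.LocalEngine

end
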